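import Summits.FinalStateConjecture.FinalStateConjecture.Theorems.EIHFluxBalanceInertialRecessionVirialFamily

/-!
# Route EIHFluxBalance — crux `InertialRecession`, abstract endgame for general `N`:
# the lever bound of the frozen-block hierarchy

Helper file for the crux `stmt-FinalStateConjecture-10166` (virial route; `InertialRecession_seat0_session8_note.md` §A(iii)).
Mathlib-only. For a node `B` of step `i` qualifying at level `ℓ` (block start `s`), the ball superset `Bb` of `exists_ball_ssuperset`
built at the configuration of step `s` either qualifies as a node of step `i` (at its own, coarser level — `ball_qualifies`) or
contains the root; in both cases every strict-superset-minimal set `Pa ⊆ 𝒦` above `B` (the parent) lies inside `Bb`, so along the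
whole block the lever `X_B − X_{Pa}` is at most `3r ≤ 96 (4Λ+2)^N 2^ℓ` (`lever_le`).
-/

noncomputable section

open Finset

namespace Summit.FinalStateConjecture.FinalStateConjecture.Theorems.SublinearIsFree.Virial

open Literature.Geometry.Lorentzian

variable {N : ℕ}

/-- **The lever bound.** See the module docstring. The family of step `i` is described by `hFdef`; `Pa` is any subset of `𝒦`
containing... precisely: `B ⊂ Pa`, `Pa ⊆ 𝒦`, and `Pa ⊆ B′` for every `B′ ∈ F i` with `B ⊂ B′` (parent minimality). The root is
`1`-gapped at the block start (vacuous external clause when `𝒦 = univ`). [folklore] -/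
theorem lever_le (ξ : Fin N → ℝ → E3) (𝒦 : Finset (Fin N)) (M : Fin N → ℝ) (hM : ∀ i, 0 < M i) {Λ h T : ℝ} {k₀ L n : ℕ}
    (F : ℕ → Finset (Finset (Fin N)))
    (hFdef : ∀ i B, B ∈ F i ↔ B ⊂ 𝒦 ∧ B.Nonempty ∧ ∃ ℓ : ℕ, k₀ ≤ ℓ ∧ ℓ < L ∧ ∃ D g : ℝ,
      (∀ x ∈ B, ∀ y ∈ B, ‖ξ x (T + (2 ^ (ℓ - k₀) * (i / 2 ^ (ℓ - k₀)) : ℕ) * h) -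
        ξ y (T + (2 ^ (ℓ - k₀) * (i / 2 ^ (ℓ - k₀)) : ℕ) * h)‖ ≤ D) ∧
      (∀ x ∈ B, ∀ z ∈ univ \ B, g ≤ ‖ξ x (T + (2 ^ (ℓ - k₀) * (i / 2 ^ (ℓ - k₀)) : ℕ) * h) -
        ξ z (T + (2 ^ (ℓ - k₀) * (i / 2 ^ (ℓ - k₀)) : ℕ) * h)‖) ∧
      (∃ x₀ ∈ B, ∃ z₀ ∈ univ \ B, ‖ξ x₀ (T + (2 ^ (ℓ - k₀) * (i / 2 ^ (ℓ - k₀)) : ℕ) * h) -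
        ξ z₀ (T + (2 ^ (ℓ - k₀) * (i / 2 ^ (ℓ - k₀)) : ℕ) * h)‖ < 2 * g) ∧
      Λ * D < g ∧ (2 : ℝ) ^ ℓ ≤ g ∧ g < (2 : ℝ) ^ (ℓ + 3))
    (hΛ : 32 ≤ Λ) (hh0 : 0 ≤ h) (hhk : ∀ ℓ, k₀ ≤ ℓ → (2 : ℝ) ^ (ℓ - k₀) * h ≤ (2 : ℝ) ^ ℓ * (h / 2 ^ k₀))
    (hδ : h / 2 ^ k₀ * (Λ + 1) ≤ 1 / 4)
    (hmove : ∀ x (m m' : ℕ), m ≤ m' → ‖ξ x (T + m' * h) - ξ x (T + m * h)‖ ≤ (m' - m) * h)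
    (hL : ∀ i ≤ n, ∀ x y : Fin N, ‖ξ x (T + i * h) - ξ y (T + i * h)‖ < (2 : ℝ) ^ L)
    {i : ℕ} (hin : i ≤ n)
    (hroot : ∀ m ≤ n, ∃ D G : ℝ, (∀ x ∈ 𝒦, ∀ y ∈ 𝒦, ‖ξ x (T + m * h) - ξ y (T + m * h)‖ ≤ D) ∧
      (∀ x ∈ 𝒦, ∀ z ∈ univ \ 𝒦, G ≤ ‖ξ x (T + m * h) - ξ z (T + m * h)‖) ∧ 1 * D < G)
    {B : Finset (Fin N)} {ℓ : ℕ} (hB : B ⊂ 𝒦) (hBne : B.Nonempty) (hk₀ : k₀ ≤ ℓ) {D g : ℝ}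
    (hD : ∀ x ∈ B, ∀ y ∈ B, ‖ξ x (T + (2 ^ (ℓ - k₀) * (i / 2 ^ (ℓ - k₀)) : ℕ) * h) -
        ξ y (T + (2 ^ (ℓ - k₀) * (i / 2 ^ (ℓ - k₀)) : ℕ) * h)‖ ≤ D)
    (hnear : ∃ x₀ ∈ B, ∃ z₀ ∈ univ \ B, ‖ξ x₀ (T + (2 ^ (ℓ - k₀) * (i / 2 ^ (ℓ - k₀)) : ℕ) * h) -
        ξ z₀ (T + (2 ^ (ℓ - k₀) * (i / 2 ^ (ℓ - k₀)) : ℕ) * h)‖ < 2 * g)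
    (hgap : Λ * D < g) (hℓg : (2 : ℝ) ^ ℓ ≤ g) (hgℓ : g < (2 : ℝ) ^ (ℓ + 3))
    {Pa : Finset (Fin N)} (hBPa : B ⊂ Pa) (hPa𝒦 : Pa ⊆ 𝒦) (hPamin : ∀ B' ∈ F i, B ⊂ B' → Pa ⊆ B')
    {i' : ℕ} (h1 : 2 ^ (ℓ - k₀) * (i / 2 ^ (ℓ - k₀)) ≤ i') (h2 : i' ≤ 2 ^ (ℓ - k₀) * (i / 2 ^ (ℓ - k₀)) + 2 ^ (ℓ - k₀)) :
    ‖(∑ k ∈ B, M k)⁻¹ • ∑ k ∈ B, M k • ξ k (T + i' * h) - (∑ k ∈ Pa, M k)⁻¹ • ∑ k ∈ Pa, M k • ξ k (T + i' * h)‖ ≤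
      96 * (4 * Λ + 2) ^ N * (2 : ℝ) ^ ℓ := by
  have hΛ1 : 1 ≤ Λ := by linarith
  set s : ℕ := 2 ^ (ℓ - k₀) * (i / 2 ^ (ℓ - k₀)) with hs
  set c : Fin N → E3 := fun x ↦ ξ x (T + (s : ℕ) * h) with hc
  have hpos2 : (0 : ℝ) < 2 ^ ℓ := pow_pos (by norm_num) ℓ
  have hg0 : 0 < g := hpos2.trans_le hℓg
  -- the ball superset at the block start
  obtain ⟨Bb, r, hBBb, hint, hext, h4g, hrle⟩ :=
    exists_ball_ssuperset (ξ := c) (B := B) hΛ1 hBne hD hg0 hgap hnear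
  have hr0 : 0 < r := by linarith
  -- `Pa ⊆ Bb`
  have hsn : s ≤ n := (blockStart_le _ _).trans hin
  have hPaBb : Pa ⊆ Bb := by
    by_cases hcase : Bb ⊂ 𝒦
    · -- `Bb` is a node of step `i`: it qualifies at its own level `ℓ⋆`
      apply hPamin Bb ?_ hBBb
      rw [hFdef]
      refine ⟨hcase, ⟨_, hBBb.1 hBne.choose_spec⟩, ?_⟩
      -- the actual gap `G₀` of `Bb` at the block start (outsiders exist since `Bb ⊂ 𝒦 ⊆ univ`)
      have hout : ((univ \ Bb) ×ˢ Bb).Nonempty := by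
        obtain ⟨z, hz, hzB⟩ := Finset.exists_of_ssubset hcase
        obtain ⟨x, hx⟩ := hBne
        exact ⟨(z, x), Finset.mem_product.mpr ⟨Finset.mem_sdiff.mpr ⟨Finset.mem_univ _, hzB⟩, hBBb.1 hx⟩⟩
      obtain ⟨q₀, hq₀, hq₀min⟩ := Finset.exists_min_image _ (fun q : Fin N × Fin N ↦ ‖c q.2 - c q.1‖) hout
      set G₀ : ℝ := ‖c q₀.2 - c q₀.1‖ with hG₀
      have hq₀1 : q₀.1 ∈ univ \ Bb := (Finset.mem_product.mp hq₀).1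
      have hq₀2 : q₀.2 ∈ Bb := (Finset.mem_product.mp hq₀).2
      have hextG : ∀ x ∈ Bb, ∀ z ∈ univ \ Bb, G₀ ≤ ‖c x - c z‖ := fun x hx z hz ↦
        hq₀min (z, x) (Finset.mem_product.mpr ⟨hz, hx⟩)
      have hG₀r : (4 * Λ + 1) * r ≤ G₀ := hext q₀.2 hq₀2 q₀.1 hq₀1
      have h1ℓ : (1 : ℝ) ≤ 2 ^ ℓ := one_le_pow₀ (by norm_num)
      have hrG : 1 * r ≤ (4 * Λ + 1) * r := mul_le_mul_of_nonneg_right (by linarith) hr0.le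
      have hG₀2 : 2 ≤ G₀ := by linarith
      obtain ⟨ℓs, hℓs1, hℓs2⟩ := exists_level_of_two_le hG₀2
      -- `ℓ⋆ ≥ ℓ + 2` and `ℓ⋆ < L`
      have h2ℓ3 : (2 : ℝ) ^ (ℓ + 3) = 2 ^ ℓ * 8 := by ring
      have hℓℓs : ℓ + 2 ≤ ℓs := by
        by_contra hlt
        push Not at hlt
        have h1' : (2 : ℝ) ^ (ℓs + 2) ≤ 2 ^ (ℓ + 3) := pow_le_pow_right₀ (by norm_num) (by omega)
        -- `G₀ < 2^{ℓs+2} ≤ 2^{ℓ+3} = 8·2^ℓ ≤ 8 g ≤ 2 r < (4Λ+1) r ≤ G₀`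
        have hG8 : G₀ < 8 * g := by rw [h2ℓ3] at h1'; linarith
        have h2r : 2 * r < (4 * Λ + 1) * r := by nlinarith
        linarith
      have hk₀s : k₀ ≤ ℓs := by omega
      have hℓsL : ℓs < L := by
        by_contra hle
        push Not at hle
        have h1' : (2 : ℝ) ^ L ≤ 2 ^ (ℓs + 1) := pow_le_pow_right₀ (by norm_num) (by omega)
        have := hL s hsn q₀.2 q₀.1
        simp only [hc] at hG₀
        linarith
      refine ⟨ℓs, hk₀s, hℓsL, ?_⟩
      -- transport from `s` back to the (earlier) block start `s⋆` of level `ℓ⋆`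
      set ss : ℕ := 2 ^ (ℓs - k₀) * (i / 2 ^ (ℓs - k₀)) with hss
      obtain ⟨hss1, hss2⟩ := blockStart_mem_coarser (d := ℓ - k₀) (d' := ℓs - k₀) (by omega) i
      have hμ : ∀ x, ‖ξ x (T + (ss : ℕ) * h) - c x‖ ≤ (2 : ℝ) ^ (ℓs - k₀) * h := fun x ↦ by
        simp only [hc]
        rw [norm_sub_rev]
        refine (hmove x ss s hss1).trans (mul_le_mul_of_nonneg_right ?_ hh0)
        have hss2' : s < ss + 2 ^ (ℓs - k₀) := hss2
        have : ((s : ℕ) : ℝ) < ((ss + 2 ^ (ℓs - k₀) : ℕ) : ℝ) := by exact_mod_cast hss2'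
        push_cast at this
        linarith
      have hμle : (2 : ℝ) ^ (ℓs - k₀) * h ≤ h / 2 ^ k₀ * G₀ / 2 := by
        refine (hhk ℓs hk₀s).trans ?_
        have h2s : (2 : ℝ) ^ (ℓs + 1) = 2 ^ ℓs * 2 := by ring
        have hδ0 : 0 ≤ h / 2 ^ k₀ := by positivity
        have hle : (2 : ℝ) ^ ℓs ≤ G₀ / 2 := by rw [h2s] at hℓs1; linarith
        calc (2 : ℝ) ^ ℓs * (h / 2 ^ k₀) = (h / 2 ^ k₀) * 2 ^ ℓs := mul_comm _ _
          _ ≤ (h / 2 ^ k₀) * (G₀ / 2) := mul_le_mul_of_nonneg_left hle hδ0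
          _ = h / 2 ^ k₀ * G₀ / 2 := by ring
      obtain ⟨hD', hg', hgap', hnear', hlo', hhi'⟩ :=
        ball_qualifies (ξ := c) (Bb := Bb) (δ₁ := h / 2 ^ k₀) hμ hΛ1 hr0 hδ hint hextG hG₀r (le_of_eq hG₀.symm)
          hℓs1 hℓs2 hμle
      exact ⟨2 * r + 2 * ((2 : ℝ) ^ (ℓs - k₀) * h), G₀ - 2 * ((2 : ℝ) ^ (ℓs - k₀) * h), hD', hg',
        ⟨q₀.2, hq₀2, q₀.1, hq₀1, hnear'⟩, hgap', hlo', hhi'⟩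
    · -- otherwise the root lies inside `Bb` (laminarity at the block start), and `Pa ⊆ 𝒦`
      refine hPa𝒦.trans ?_
      obtain ⟨DK, GK, hDK, hGK, hgapK⟩ := hroot s hsn
      have hlam := gapped_laminar' (s := univ) (B := 𝒦) (B' := Bb) (ξ := c) (Λ := 1) le_rfl (Finset.subset_univ _)
        (Finset.subset_univ _) hDK hGK (fun x hx y hy ↦ (hint x hx y hy).le) hext hgapK (by nlinarith)
        (by obtain ⟨x, hx⟩ := hBne; exact ⟨x, Finset.mem_inter.mpr ⟨hB.1 hx, hBBb.1 hx⟩⟩)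
      rcases hlam with h | h
      · exact h
      · by_contra hK
        exact hcase (Finset.ssubset_iff_subset_ne.mpr ⟨h, fun heq ↦ hK (heq ▸ Finset.Subset.refl _)⟩)
  -- levers at step `i'`: everything inside `Bb`, whose diameter is `< 2r + 2·(2^ℓ h / 2^{k₀}) ≤ 3r`
  have hμ' : ∀ x, ‖ξ x (T + i' * h) - c x‖ ≤ (2 : ℝ) ^ (ℓ - k₀) * h := fun x ↦
    (hmove x s i' h1).trans (mul_le_mul_of_nonneg_right (by
      have h2' : i' ≤ s + 2 ^ (ℓ - k₀) := h2
      have : ((i' : ℕ) : ℝ) ≤ ((s + 2 ^ (ℓ - k₀) : ℕ) : ℝ) := by exact_mod_cast h2'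
      push_cast at this; linarith) hh0)
  obtain ⟨hint', -⟩ := controlled_transport (B := Bb) hμ' (fun x hx y hy ↦ (hint x hx y hy).le) hext
  have hdiam : ∀ x ∈ Bb, ∀ y ∈ Bb, ‖ξ x (T + i' * h) - ξ y (T + i' * h)‖ ≤ 3 * r := by
    intro x hx y hy
    refine (hint' x hx y hy).trans ?_
    have h1' := hhk ℓ hk₀
    have hδ4 : h / 2 ^ k₀ ≤ 1 / 4 := by
      have : h / 2 ^ k₀ * 1 ≤ h / 2 ^ k₀ * (Λ + 1) := by
        apply mul_le_mul_of_nonneg_left (by linarith) (by positivity)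
      linarith
    nlinarith
  have hlev := norm_centre_sub_centre_le (ξ := fun x ↦ ξ x (T + i' * h)) (M := M) (S := Bb) (A := B) (A' := Pa) hM
    hBBb.1 hPaBb hBne ⟨_, hBPa.1 hBne.choose_spec⟩ hdiam
  refine hlev.trans ?_
  -- `3r ≤ 3 (4Λ+2)^N 4 g < 96 (4Λ+2)^N 2^ℓ`
  have hcard : Fintype.card (Fin N) = N := Fintype.card_fin N
  rw [hcard] at hrle
  have hpow : (0 : ℝ) ≤ (4 * Λ + 2) ^ N := by positivity
  have h2ℓ3 : (2 : ℝ) ^ (ℓ + 3) = 2 ^ ℓ * 8 := by ring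
  have hg8 : 4 * g ≤ 32 * 2 ^ ℓ := by rw [h2ℓ3] at hgℓ; linarith
  have hr32 : r ≤ (4 * Λ + 2) ^ N * (32 * 2 ^ ℓ) := hrle.trans (mul_le_mul_of_nonneg_left hg8 hpow)
  linarith

/-- Registered one-line form of `lever_le` (the lever bound of the frozen-block hierarchy). [folklore] -/
theorem lever_le_of_blocks : open Literature.Geometry.Lorentzian Finset in ∀ {N : ℕ} (ξ : Fin N → ℝ → E3) (𝒦 : Finset (Fin N)) (M : Fin N → ℝ), (∀ i, 0 < M i) → ∀ {Λ h T : ℝ} {k₀ L n : ℕ} (F : ℕ → Finset (Finset (Fin N))), (∀ i B, B ∈ F i ↔ B ⊂ 𝒦 ∧ B.Nonempty ∧ ∃ ℓ : ℕ, k₀ ≤ ℓ ∧ ℓ < L ∧ ∃ D g : ℝ, (∀ x ∈ B, ∀ y ∈ B, ‖ξ x (T + (2 ^ (ℓ - k₀) * (i / 2 ^ (ℓ - k₀)) : ℕ) * h) - ξ y (T + (2 ^ (ℓ - k₀) * (i / 2 ^ (ℓ - k₀)) : ℕ) * h)‖ ≤ D) ∧ (∀ x ∈ B, ∀ z ∈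 univ \ B, g ≤ ‖ξ x (T + (2 ^ (ℓ - k₀) * (i / 2 ^ (ℓ - k₀)) : ℕ) * h) - ξ z (T + (2 ^ (ℓ - k₀) * (i / 2 ^ (ℓ - k₀)) : ℕ) * h)‖) ∧ (∃ x₀ ∈ B, ∃ z₀ ∈ univ \ B, ‖ξ x₀ (T + (2 ^ (ℓ - k₀) * (i / 2 ^ (ℓ - k₀)) : ℕ) * h) - ξ z₀ (T + (2 ^ (ℓ - k₀) * (i / 2 ^ (ℓ - k₀)) : ℕ) * h)‖ < 2 * g) ∧ Λ * D < g ∧ (2 : ℝ) ^ ℓ ≤ g ∧ g < (2 : ℝ) ^ (ℓ + 3)) → 32 ≤ Λ → 0 ≤ h → (∀ ℓ, k₀ ≤ ℓ → (2 : ℝ) ^ (ℓ - k₀) * h ≤ (2 : ℝ) ^ ℓ * (h / 2 ^ k₀)) → h / 2 ^ k₀ * (Λ + 1) ≤ 1 / 4 → (∀ x (m m' : ℕ), m ≤ m' → ‖ξ x (T + m' * h) - ξ x (T + m * h)‖ ≤ (m' - m) * h) → (∀ i ≤ n, ∀ x y : Fin N, ‖ξ x (T + i * h) - ξ y (T + i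 * h)‖ < (2 : ℝ) ^ L) → ∀ {i : ℕ}, i ≤ n → (∀ m ≤ n, ∃ D G : ℝ, (∀ x ∈ 𝒦, ∀ y ∈ 𝒦, ‖ξ x (T + m * h) - ξ y (T + m * h)‖ ≤ D) ∧ (∀ x ∈ 𝒦, ∀ z ∈ univ \ 𝒦, G ≤ ‖ξ x (T + m * h) - ξ z (T + m * h)‖) ∧ 1 * D < G) → ∀ {B : Finset (Fin N)} {ℓ : ℕ}, B ⊂ 𝒦 → B.Nonempty → k₀ ≤ ℓ → ∀ {D g : ℝ}, (∀ x ∈ B, ∀ y ∈ B, ‖ξ x (T + (2 ^ (ℓ - k₀) * (i / 2 ^ (ℓ - k₀)) : ℕ) * h) - ξ y (T + (2 ^ (ℓ - k₀) * (i / 2 ^ (ℓ - k₀)) : ℕ) * h)‖ ≤ D) → (∃ x₀ ∈ B, ∃ z₀ ∈ univ \ B, ‖ξ x₀ (T + (2 ^ (ℓ - k₀) * (i / 2 ^ (ℓ - k₀)) : ℕ) * h) - ξ z₀ (T + (2 ^ (ℓ - k₀) * (i / 2 ^ (ℓ - k₀)) : ℕ) * h)‖ < 2 * g) → Λ * D <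 g → (2 : ℝ) ^ ℓ ≤ g → g < (2 : ℝ) ^ (ℓ + 3) → ∀ {Pa : Finset (Fin N)}, B ⊂ Pa → Pa ⊆ 𝒦 → (∀ B' ∈ F i, B ⊂ B' → Pa ⊆ B') → ∀ {i' : ℕ}, 2 ^ (ℓ - k₀) * (i / 2 ^ (ℓ - k₀)) ≤ i' → i' ≤ 2 ^ (ℓ - k₀) * (i / 2 ^ (ℓ - k₀)) + 2 ^ (ℓ - k₀) → ‖(∑ k ∈ B, M k)⁻¹ • ∑ k ∈ B, M k • ξ k (T + i' * h) - (∑ k ∈ Pa, M k)⁻¹ • ∑ k ∈ Pa, M k • ξ k (T + i' * h)‖ ≤ 96 * (4 * Λ + 2) ^ N * (2 : ℝ) ^ ℓ :=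
  fun ξ 𝒦 M hM _ _ _ _ _ _ F hFdef hΛ hh0 hhk hδ hmove hL _ hin hroot _ _ hB hBne hk₀ _ _ hD hnear hgap hℓg hgℓ _ hBPa hPa𝒦 hPamin _ h1 h2 ↦
    lever_le ξ 𝒦 M hM F hFdef hΛ hh0 hhk hδ hmove hL hin hroot hB hBne hk₀ hD hnear hgap hℓg hgℓ hBPa hPa𝒦 hPamin h1 h2

end Summit.FinalStateConjecture.FinalStateConjecture.Theorems.SublinearIsFree.Virial

end
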